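import Summits.QuantumFields.YangMills.Theorems.LuscherReductionTwistedTraceScalingBaseWindow
import Summits.QuantumFields.YangMills.Theorems.LuscherReductionTwistedTraceScalingOneSiteTraceLimit
import Summits.QuantumFields.YangMills.Theorems.TwistedTraceScaling.Negative.FixedLatticeTraceLawFalseWithoutThreshold
import Summits.QuantumFields.YangMills.Theorems.TwistedTraceScaling.Negative.StrongCouplingBranch
import HarnessLib


/-!
# `TwistedTraceScaling` (crux stmt-QuantumFields-20203, route `LuscherReduction`, skeleton «twolattice»):
# negative-side support III — the hypothesis `1 ≤ β` of `InFemtoWindow` is load-bearing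
# (refuter crux-disprover seat; this file does NOT refute the crux)

HONEST FRAMING: `TwistedTraceScaling` is a femto-rung (R2b1) crux of a CONDITIONAL reduction route; nothing here is a
mass-gap or Clay statement.  All objects are the tree's: `TT.physTrace`, `TraceDoor.traceRatio`, `TraceDoor.hTraceRatio`,
`luscherLambda`, `oneSiteCoupling`, `bareLambda`.

`twistedTraceScaling_false_without_betaGeOne`: the crux with `1 ≤ β` removed from the window (and the lattice threshold
`∃ L0, ∀ L ≥ L0` removed; the statement is spelled out inline — no proposition is defined under `Summits/`) is FALSE.  Witness
`s = 1`, `ε = (1 − r_𝔥(1))/4` (`hTraceRatio_lt_one`, landed), `L = 1`, a small depth `lam`, and the STRONG-coupling root `β` of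
`Λ(β, 1) = lam` (`StrongCouplingBranch.exists_strong_window`): the `L`-side ratio is `≥ 1 − 4cβ⌈1/lam⌉ ≥ 1 − ε` since
`β⌈1/lam⌉ ≲ e^{−(b₀/b₁)/lam³}/lam` (`one_sub_le_traceRatio`), whereas the one-site side sits at the LARGE coupling `B = 2/lam³`
(`bareLambda B = lam`, `⌈1/lam⌉·lam ∈ [1, 1 + lam]`) and is within `ε` of `r_𝔥(1) = 1 − 4ε` by the landed one-site trace limit
`TraceDoor.oneSiteTraceLimit` (S-OSTL) and `Base.traceRatio_eq_levelRatio`.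

Why the threshold is dropped too, and why the failure is nevertheless attributable to `1 ≤ β`.  With `∃ L0, ∀ L ≥ L0` kept, `L ≥ L0(lam)`
is adversarial; the strong root then behaves like `β ≈ 2b₀·L^{−2b₀²/b₁}·e^{−(b₀/b₁)/lam³}` (`2b₀²/b₁ = 121/51`) while `c = 18L³` and
`T ≈ sL/lam`, so the pointwise exponent `4cβT ∝ L^{4 − 121/51}` GROWS with `L`: closing that case needs an `L`-uniform strong-coupling
(polymer) expansion of `traceRatio`, which the tree does not have — recorded as a near-miss in the crux workfile
`Cruxes/TwistedTraceScaling/Disproof.lean`.  Conversely, WITH `1 ≤ β` the threshold-free variant (`∀ L ≥ 1`) follows from the skeleton's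
own stubs (S-BASE at each small `L`, S-TOWER, S-OSTL) exactly as the crux does, so of the two dropped hypotheses only `1 ≤ β` can carry the
failure.  Moral: `1 ≤ β` is what selects the weak-coupling root of the label equation; a restatement of the crux with the two-sided window
but without `1 ≤ β` is refutable by this theorem.
-/


set_option autoImplicit false

noncomputable section

open MeasureTheory Filter Topology Real
open Literature.MathematicalPhysics.QuantumFieldTheory hiding SU2
open Literature.MathematicalPhysics.QuantumLattice
open Literature.Analysis.OperatorTheory.YMMatrixModel
open scoped BigOperators

namespace Summit.QuantumFields.YangMills.Theorems.TwistedTraceScaling.Negative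

open Summit.QuantumFields.YangMills.Theorems.FemtoTransferGap
open Summit.QuantumFields.YangMills.Theorems.FemtoTransferGap.TraceDoor
open Summit.QuantumFields.YangMills.Theorems.FemtoTransferGap.TT
open Summit.QuantumFields.YangMills.Theorems.FemtoTransferGap.TwoLattice

/-! ## §4 The crux is false without `1 ≤ β`: the strong-coupling root of the window equation -/

/-- **`TwistedTraceScaling` is false without the hypothesis `1 ≤ β` of `InFemtoWindow`** (with the lattice threshold `∃ L0, ∀ L ≥ L0`
also removed, which by itself is harmless — see the module docstring).  Witness: `s = 1`, `ε = (1 − r_𝔥(1))/4`, the one-link lattice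
`L = 1`, a small depth `lam`, and the STRONG-coupling root `0 < β < 1`, `β ≤ 2b₀e^{b₀/(2b₁)}e^{−(b₀/b₁)/lam³}`, of `Λ(β, 1) = lam`:
there the `L`-side trace ratio is `≥ 1 − 4·c₁·β·⌈1/lam⌉ ≥ 1 − ε` (kernel sandwich, `c₁ = 2|E|+4|P|` at `L = 1`), while the one-site
side sits at the LARGE coupling `B = 2/lam³` with `⌈1/lam⌉·λ_b(B) ∈ [1, 1+lam]`, so it is within `ε` of `r_𝔥(1) < 1` by the landed
one-site trace limit `TraceDoor.oneSiteTraceLimit`; the two sides differ by more than `ε`. [folklore] -/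
theorem twistedTraceScaling_false_without_betaGeOne :
    ¬ (∀ s : ℝ, 0 < s → ∀ ε : ℝ, 0 < ε → ∃ lam0 : ℝ, 0 < lam0 ∧ ∀ lam : ℝ, 0 < lam → lam ≤ lam0 →
        ∀ (L : ℕ) [NeZero L] (β : ℝ), lam ≤ luscherLambda β L → luscherLambda β L ≤ 2 * lam →
          |physTrace L β (2 * ⌈s * L / luscherLambda β L⌉₊) / physTrace L β ⌈s * L / luscherLambda β L⌉₊ ^ 2 -
            physTrace 1 (oneSiteCoupling β L) (2 * ⌈s * L / luscherLambda β L⌉₊) /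
              physTrace 1 (oneSiteCoupling β L) ⌈s * L / luscherLambda β L⌉₊ ^ 2| ≤ ε) := by
  intro h
  have hr1 : hTraceRatio 1 < 1 := hTraceRatio_lt_one one_pos
  obtain ⟨g, hg⟩ : ∃ g : ℝ, g = 1 - hTraceRatio 1 := ⟨_, rfl⟩
  have hg0 : 0 < g := by rw [hg]; linarith
  obtain ⟨lam0, hlam0, H⟩ := h 1 one_pos (g / 4) (by positivity)
  obtain ⟨B0, hO⟩ := oneSiteTraceLimit 1 one_pos (g / 4) (by positivity)
  have hb0 : 0 < b0 := by unfold b0; positivity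
  have hb1 : 0 < b1 := by unfold b1; positivity
  obtain ⟨c1, hc1⟩ : ∃ c1 : ℝ, c1 = 2 * (Fintype.card (Edge 3 1) : ℝ) + 4 * (Fintype.card (Plaquette 3 1) : ℝ) := ⟨_, rfl⟩
  have hc1nn : 0 ≤ c1 := by rw [hc1]; positivity
  obtain ⟨κ, hκ⟩ : ∃ κ : ℝ, κ = b0 / b1 := ⟨_, rfl⟩
  have hκ0 : 0 < κ := by rw [hκ]; exact div_pos hb0 hb1
  obtain ⟨C, hC⟩ : ∃ C : ℝ, C = 16 * b0 * Real.exp (κ / 2) * (c1 + 1) / κ := ⟨_, rfl⟩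
  have hC0 : 0 < C := by rw [hC]; positivity
  obtain ⟨M, hM⟩ : ∃ M : ℝ, M = max B0 1 := ⟨_, rfl⟩
  have hM1 : 1 ≤ M := by rw [hM]; exact le_max_right _ _
  have hMB : B0 ≤ M := by rw [hM]; exact le_max_left _ _
  have hM0 : 0 < M := by linarith
  -- the depth `lam`
  obtain ⟨lam, hlam_pos, hlam_le0, hlam_half, hlam_M, hlam_g⟩ :
      ∃ lam : ℝ, 0 < lam ∧ lam ≤ lam0 ∧ lam ≤ 1 / 2 ∧ lam ≤ 1 / M ∧ lam ≤ g / (4 * C) := by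
    refine ⟨min lam0 (min (1 / 2) (min (1 / M) (g / (4 * C)))),
      lt_min hlam0 (lt_min (by norm_num) (lt_min (by positivity) (by positivity))), min_le_left _ _,
      (min_le_right _ _).trans (min_le_left _ _),
      (min_le_right _ _).trans ((min_le_right _ _).trans (min_le_left _ _)),
      (min_le_right _ _).trans ((min_le_right _ _).trans (min_le_right _ _))⟩
  have hlam_one : lam ≤ 1 := by linarith
  -- the strong-coupling root at `L = 1` with `Λ(β, 1) = lam`
  obtain ⟨β, hβ0, -, hβle, hΛ⟩ := exists_strong_window 1 hlam_pos hlam_one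
  -- the hypothesis at `(lam, L = 1, β)`
  have hH := H lam hlam_pos hlam_le0 1 β (by rw [hΛ]) (by rw [hΛ]; linarith)
  simp only [Nat.cast_one, mul_one, hΛ] at hH
  have hB : oneSiteCoupling β 1 = 2 / lam ^ 3 := by unfold oneSiteCoupling; rw [hΛ]; simp
  rw [hB] at hH
  obtain ⟨T, hT⟩ : ∃ T : ℕ, T = ⌈(1 : ℝ) / lam⌉₊ := ⟨_, rfl⟩
  rw [← hT] at hH
  change |traceRatio 1 β T - traceRatio 1 (2 / lam ^ 3) T| ≤ g / 4 at hH
  -- facts about `T = ⌈1/lam⌉`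
  have hinv : 2 ≤ 1 / lam := by rw [le_div_iff₀ hlam_pos]; linarith
  have hceil : (1 : ℝ) / lam ≤ T := by rw [hT]; exact Nat.le_ceil _
  have hceil' : (T : ℝ) < 1 / lam + 1 := by rw [hT]; exact Nat.ceil_lt_add_one (by positivity)
  have hT2 : 2 ≤ T := by
    have : (2 : ℝ) ≤ (T : ℝ) := hinv.trans hceil
    exact_mod_cast this
  have hT1 : 1 ≤ T := le_trans (by norm_num) hT2
  have hTle : (T : ℝ) ≤ 2 / lam := by
    have : (2 : ℝ) / lam = 1 / lam + 1 / lam := by ring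
    linarith
  -- facts about `B = 2/lam³`
  have hlam3 : lam ^ 3 ≤ lam := by
    have h1 : lam ^ 2 ≤ 1 := by nlinarith
    nlinarith
  have hBM : 2 * M ≤ 2 / lam ^ 3 := by
    have h1 : M ≤ 1 / lam := by
      rw [le_div_iff₀ hlam_pos]
      calc M * lam ≤ M * (1 / M) := mul_le_mul_of_nonneg_left hlam_M hM0.le
        _ = 1 := by field_simp
    have h2 : 1 / lam ≤ 1 / lam ^ 3 := one_div_le_one_div_of_le (by positivity) hlam3
    have h3 : (2 : ℝ) / lam ^ 3 = 2 * (1 / lam ^ 3) := by ring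
    linarith
  have hB0 : B0 ≤ 2 / lam ^ 3 := by linarith
  have hB1 : (1 : ℝ) ≤ 2 / lam ^ 3 := by linarith
  -- the one-site side: OSTL at `B = 2/lam³`, `T`
  have hbare : bareLambda (2 / lam ^ 3) = lam := by
    have h1 := bareLambda_oneSiteCoupling (β := β) (L := 1) (by rw [hΛ]; exact hlam_pos)
    rw [hB, hΛ] at h1
    simpa using h1
  have hOT : |(T : ℝ) * bareLambda (2 / lam ^ 3) - 1| ≤ bareLambda (2 / lam ^ 3) := by
    rw [hbare, abs_le]
    constructor
    · have h1 : (1 : ℝ) ≤ T * lam := by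
        calc (1 : ℝ) = (1 / lam) * lam := by field_simp
          _ ≤ T * lam := mul_le_mul_of_nonneg_right hceil hlam_pos.le
      linarith
    · have h1 : (T : ℝ) * lam < (1 / lam + 1) * lam := mul_lt_mul_of_pos_right hceil' hlam_pos
      have h2 : (1 / lam + 1) * lam = 1 + lam := by field_simp
      linarith
  have hO1 := hO (2 / lam ^ 3) hB0 T hOT
  rw [← Base.traceRatio_eq_levelRatio 1 hB1 hT2] at hO1
  -- the `L`-side at the strong-coupling root: `r ≥ 1 − 4 c₁ β T ≥ 1 − g/4`
  have hlow := one_sub_le_traceRatio 1 hβ0.le hT1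
  rw [← hc1] at hlow
  have hsmall : 4 * (c1 * β) * T ≤ g / 4 := by
    have he : Real.exp (-(b0 / b1) * (1 / lam ^ 3 - 1 / 2)) = Real.exp (κ / 2) * Real.exp (-(κ / lam ^ 3)) := by
      rw [← Real.exp_add, hκ]; congr 1; ring
    have hx : 0 < κ / lam ^ 3 := by positivity
    have hex : Real.exp (-(κ / lam ^ 3)) ≤ lam ^ 3 / κ := by
      have h1 : κ / lam ^ 3 + 1 ≤ Real.exp (κ / lam ^ 3) := Real.add_one_le_exp _
      rw [Real.exp_neg]
      calc (Real.exp (κ / lam ^ 3))⁻¹ ≤ (κ / lam ^ 3)⁻¹ := inv_anti₀ hx (by linarith)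
        _ = lam ^ 3 / κ := by rw [inv_div]
    have hβ' : β ≤ 2 * b0 * Real.exp (κ / 2) * (lam ^ 3 / κ) := by
      calc β ≤ 2 * b0 * Real.exp (-(b0 / b1) * (1 / lam ^ 3 - 1 / 2)) := hβle
        _ = 2 * b0 * Real.exp (κ / 2) * Real.exp (-(κ / lam ^ 3)) := by rw [he]; ring
        _ ≤ 2 * b0 * Real.exp (κ / 2) * (lam ^ 3 / κ) := mul_le_mul_of_nonneg_left hex (by positivity)
    have hE0 : 0 < Real.exp (κ / 2) := Real.exp_pos _
    calc 4 * (c1 * β) * T ≤ 4 * (c1 * (2 * b0 * Real.exp (κ / 2) * (lam ^ 3 / κ))) * (2 / lam) := by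
          apply mul_le_mul _ hTle (by positivity) (by positivity)
          exact mul_le_mul_of_nonneg_left (mul_le_mul_of_nonneg_left hβ' hc1nn) (by norm_num)
      _ = (16 * b0 * Real.exp (κ / 2) * c1 / κ) * lam ^ 2 := by field_simp; ring
      _ ≤ C * lam ^ 2 := by
          apply mul_le_mul_of_nonneg_right _ (by positivity)
          rw [hC]
          apply div_le_div_of_nonneg_right _ hκ0.le
          exact mul_le_mul_of_nonneg_left (by linarith) (by positivity)
      _ ≤ C * lam := by
          apply mul_le_mul_of_nonneg_left _ hC0.le
          have h1 : lam ^ 2 = lam * lam := by ring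
          rw [h1]
          exact mul_le_of_le_one_right hlam_pos.le hlam_one
      _ ≤ C * (g / (4 * C)) := mul_le_mul_of_nonneg_left hlam_g hC0.le
      _ = g / 4 := by field_simp
  -- contradiction: `r_β ≥ 1 − g/4`, `|r_β − r_B| ≤ g/4`, `|r_B − r_𝔥(1)| ≤ g/4`, `g = 1 − r_𝔥(1) > 0`
  have h1 : traceRatio 1 β T - traceRatio 1 (2 / lam ^ 3) T ≤ g / 4 := (abs_le.mp hH).2
  have h2 : traceRatio 1 (2 / lam ^ 3) T - hTraceRatio 1 ≤ g / 4 := (abs_le.mp hO1).2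
  linarith only [hlow, hsmall, h1, h2, hg, hg0]

end Summit.QuantumFields.YangMills.Theorems.TwistedTraceScaling.Negative

end
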